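import Literature.MathematicalPhysics.QuantumFieldTheory.Balaban1983to89.B9Eq347GlobalFromLocalZd

/-!
# `Balaban1983to89.B9Eq347GlobalFromLocalZdFinite` — [Balaban1985BackgroundPropagators] (3.47) ⇐ (3.42) «and Lemma 2.1» for the GENUINE `G(U₀)` at the
# `ℤᵈ × 𝔸` frame, MEMBER BY MEMBER WITHOUT LETTERS: on a member with finitely many blocks the two Lemma-2.1 letters displayed by
# `B9Eq347GlobalFromLocalZd` (the exchange (2.60) and the row sum (2.61)) and the block assignment ARE INHABITED — with MEMBER-DEPENDENT constants
# (`R(x, ω, ω′)`, `S = |𝔅|`) — so (3.42)₀ at the pinned readings ALONE gives a weighted global sup bound of `G(U₀)` on that member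

statement-level skeleton of published theorems with citation tags; proofs where landed; nothing here is a claim about the
Yang–Mills mass gap

PDF held: `paper:balaban1985-cmp99-background-propagators` ([4] = B9; journal page = PDF page + 388), pp. 397–398 (3.42), (3.47), l. 19–20;
[Balaban1984PropagatorsII] p. 234 Lemma 2.1 (2.60)–(2.61) — quoted in `B9Eq347GlobalFromLocal` ∕ `B9Eq347GlobalFromLocalZd`, BY NAME.

WHY THIS FILE (cell `pub-ymgap`, HUMAN RULING D-0062 ∕ D-0149; seat `pub-ymgap-dag-n06-w2` (g0), node N06 = [B9]; count-neutral).  `B9Eq347GlobalFromLocalZd`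
(p589880) proved the four (3.47) entries of the genuine `G(U₀)` from its (3.42) readings with the Lemma-2.1 clauses as DISPLAYED letters (exchange `hex`,
row `hS`) and a displayed base-block assignment `π`.  Print's constants in (2.60)–(2.61) are UNIFORM in the member (they come from the separation (2.2) and
the cube geometry — `Sep22Zd`, not a field of `ZdIdx`, and a connectivity guard on `distZd`; HONEST SCOPE (ii) there).  This file records the weaker,
letter-free fact that needs none of that: on ONE member with finitely many blocks the letters are inhabited by crude member-dependent constants (every
decay factor `≤ 1`, so the row sum is at most the number of blocks; the exchange constant is the largest output weight times local factor over the
smallest source weight), and every bond whose base point lies in some block admits a block assignment by choice.  Value: the hypothesis set of p589880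
is jointly satisfiable (A6), and a per-member unconditional form of «(3.47) ⇐ (3.42)» for the genuine operator; NOT print's member-uniform statement.

WHAT IS PROVED (0 sorry; proof lane, one `def` = the chosen block assignment `blkChoice`).
* §1 `rowLetter_of_fintype` — `Σ_v e^{−c·d(u,v)} ≤ |𝔅|` for `c ≥ 0` (`distZd ≥ 0`); `exchangeLetter_of_fintype` — with `κ₂ := 0`,
  `ω′(u)·a(u) ≤ R·ω(v)` for `R := (max_u ω′(u)a(u)) · (max_v ω(v)⁻¹)` (`ω > 0`, `ω′a ≥ 0`, nonempty `𝔅`).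
* §2 `InSomeBlock` (the bond class «base point in some block of 𝔅»), `blkChoice` (a block assignment by choice), `blkChoice_spec`.
* §3 ★★ `weight_mul_norm_gop_le_of_ineq342_fintype` — for a finite-block member, `G(U) = ops.Gop U` ℝ-linear, `(3.42)` at the genuine readings with
  `0 ≤ δ₀`, positive block weights `ω`, non-negative `ω′`: `ω′(blk b)·‖(G(U₀) f̃)(b)‖ ≤ B₀ · R(x,ω,ω′) · |𝔅| · M` whenever `ω(blk y)·‖f(y)‖ ≤ M` — NO letter
  left (member-dependent constants, stated as such); `exchangeConst_nonneg`; the same for the entries n = 1, 2, 3: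
  ★ `weight_mul_norm_gradGop_le_of_ineq342_fintype`, ★ `weight_mul_norm_gopDiv_le_of_ineq342_fintype`, ★ `weight_mul_norm_lapGop_le_of_ineq342_fintype`.

HONEST SCOPE.  Bookkeeping over p589880; constants depend on the member (NOT print's uniform c₁(α), which needs (2.2) ∕ `Sep22Zd` and the cube geometry);
`G(U₀)` a letter; count-neutral; N05 ∕ N06 NOT discharged; one finite lattice programme at fixed `ε`; R4 closes the conditional finite-𝕋⁴ rung
`BalabanLadder.UV` only; nothing continuum ∕ ℝ⁴ ∕ OS ∕ mass-gap ∕ Clay.  Unit `pub-ymgap-dag-n06-w2` (g0), 2026-08-28.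
-/

noncomputable section

namespace Literature.MathematicalPhysics.QuantumFieldTheory.Balaban1983to89.B9Eq347GlobalFromLocalZdFinite

open B8Ineq132 (BondTouches)
open B8LeafModelZd (ZdIdx)
open B9SupplySockB9P3ZdLetters (OpsZd)
open B9SupplySockB9P3ZdFrame (MemberZd BSite blockZd CfgZd distZd distZd_nonneg)
open B9SupplySockB9P3ZdLocalLettersOfOps (GAZdOfOps)
open B9Eq347GlobalFromLocalZd (extZd weight_mul_norm_gop_le_of_ineq342)

-- `Site` alone could resolve to the torus sites of `Setup.lean`; re-export the `ℤ^d` sites of `B7Prop1Explicit`.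
export B7Prop1Explicit (Site)

variable {d : ℕ} {L : ℕ}

/-! ## §1 The two Lemma-2.1 letters on a finite member, with member-dependent constants -/

/-- **THE ROW LETTER (2.61)-shape ON A FINITE MEMBER**: every decay factor is `≤ 1`, so `Σ_{v ∈ 𝔅} e^{−c·d(u,v)} ≤ |𝔅|` (`c ≥ 0`; `d ≥ 0`).
[cite: Balaban1984PropagatorsII, Lemma 2.1 (2.61) p.234 (shape only; member-dependent constant)] -/
theorem rowLetter_of_fintype {x : MemberZd d L} [Fintype (BSite L x)] {c : ℝ} (hc : 0 ≤ c) (u : BSite L x) :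
    ∑ v, Real.exp (-(c * distZd L x u v)) ≤ (Fintype.card (BSite L x) : ℝ) := by
  calc ∑ v, Real.exp (-(c * distZd L x u v)) ≤ ∑ _v : BSite L x, (1 : ℝ) := Finset.sum_le_sum fun v _ => by
        rw [Real.exp_le_one_iff, neg_nonpos]
        exact mul_nonneg hc (distZd_nonneg L x u v)
    _ = (Fintype.card (BSite L x) : ℝ) := by simp

/-- **THE EXCHANGE LETTER (2.60)-shape ON A FINITE MEMBER** with `κ₂ := 0`: `ω′(u)·a(u) ≤ R·e^{0}·ω(v)` for
`R := (max_u ω′(u)a(u)) · (max_v ω(v)⁻¹)` (`ω > 0`, `ω′·a ≥ 0`). [cite: Balaban1984PropagatorsII, Lemma 2.1 (2.60) p.234 (shape only; member-dependent constant)] -/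
theorem exchangeLetter_of_fintype {x : MemberZd d L} [Fintype (BSite L x)] [Nonempty (BSite L x)] {ω ω' a : BSite L x → ℝ}
    (hω : ∀ v, 0 < ω v) (hω'a : ∀ u, 0 ≤ ω' u * a u) (u v : BSite L x) :
    ω' u * a u ≤ ((Finset.univ.sup' Finset.univ_nonempty fun u => ω' u * a u) *
        (Finset.univ.sup' Finset.univ_nonempty fun v => (ω v)⁻¹)) * Real.exp (0 * distZd L x u v) * ω v := by
  rw [zero_mul, Real.exp_zero, mul_one]
  have h1 : ω' u * a u ≤ Finset.univ.sup' Finset.univ_nonempty fun u => ω' u * a u :=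
    Finset.le_sup' (fun u => ω' u * a u) (Finset.mem_univ u)
  have h2 : (ω v)⁻¹ ≤ Finset.univ.sup' Finset.univ_nonempty fun v => (ω v)⁻¹ :=
    Finset.le_sup' (fun v => (ω v)⁻¹) (Finset.mem_univ v)
  have h0 : 0 ≤ Finset.univ.sup' Finset.univ_nonempty fun u => ω' u * a u := (hω'a u).trans h1
  calc ω' u * a u = ω' u * a u * ((ω v)⁻¹ * ω v) := by rw [inv_mul_cancel₀ (hω v).ne', mul_one]
    _ = ω' u * a u * (ω v)⁻¹ * ω v := by ring
    _ ≤ (Finset.univ.sup' Finset.univ_nonempty fun u => ω' u * a u) * (Finset.univ.sup' Finset.univ_nonempty fun v => (ω v)⁻¹) * ω v := by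
        have hωv : 0 ≤ ω v := (hω v).le
        have hinv : 0 ≤ (ω v)⁻¹ := inv_nonneg.2 hωv
        gcongr

/-! ## §2 The bond class «base point in some block» and a block assignment by choice -/

/-- **the bonds whose base point lies in some block of `𝔅`** — the natural bond class of `B9Eq347GlobalFromLocalZd`'s theorems at a member.
[cite: Balaban1985BackgroundPropagators, p.397 («x ∈ Δ(y), y ∈ 𝔅»)] -/
def InSomeBlock (L : ℕ) (x : MemberZd d L) (b : Site d × Fin d) : Prop :=
  ∃ y : BSite L x, b.1 ∈ blockZd L y.1.1 y.1.2

/-- **a block assignment by choice** on that class. [cite: Balaban1985BackgroundPropagators, p.397 («x ∈ Δ(y), y ∈ 𝔅»)] -/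
def blkChoice (L : ℕ) (x : MemberZd d L) (b : {b : Site d × Fin d // InSomeBlock L x b}) : BSite L x :=
  b.2.choose

/-- the chosen block contains the base point. [cite: Balaban1985BackgroundPropagators, p.397 (bookkeeping)] -/
theorem blkChoice_spec (L : ℕ) (x : MemberZd d L) (b : {b : Site d × Fin d // InSomeBlock L x b}) :
    b.1.1 ∈ blockZd L (blkChoice L x b).1.1 (blkChoice L x b).1.2 :=
  b.2.choose_spec

/-! ## §3 (3.47)₀ ⇐ (3.42)₀ for the genuine `G(U₀)`, member by member, no letter left -/

/-- ★★ **«(3.47) ⇐ (3.42) and Lemma 2.1» FOR THE GENUINE `G(U₀)` ON ONE FINITE-BLOCK MEMBER, LETTER-FREE**: `ops.Gop U` ℝ-linear, the (3.42) block of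
`B9.Ineq342_346_347 (GAZdOfOps … ops) B₀ δ₀ U` at the pinned readings with `0 ≤ B₀`, `0 ≤ δ₀`, positive source weights `ω` and non-negative output
weights `ω′` on the blocks ⟹ for every `f` on the bonds with base point in a block and `ω(blk y)·‖f(y)‖ ≤ M`:
`ω′(blk b)·‖(G(U) f̃)(b)‖ ≤ B₀·R·|𝔅|·M`, `R = (max_u ω′(u)(L^{j_u}η)²)·(max_v ω(v)⁻¹)` — member-dependent constants (print's are uniform).
[cite: Balaban1985BackgroundPropagators, Thm 3.1 (3.42) p.397 + (3.47) p.398 (l.19–20); Balaban1984PropagatorsII, Lemma 2.1 p.234] -/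
theorem weight_mul_norm_gop_le_of_ineq342_fintype {𝔸 : Type} [CStarAlgebra 𝔸] {len : Site d → ℝ} {x : MemberZd d L}
    [Fintype (BSite L x)] [Nonempty (BSite L x)] {ops : OpsZd d 𝔸} {U : CfgZd d 𝔸} {B₀ δ₀ : ℝ} (hB₀ : 0 ≤ B₀) (hδ₀ : 0 ≤ δ₀)
    (h342 : B9.Ineq342_346_347 (GAZdOfOps 𝔸 L len x ops) B₀ δ₀ U)
    (hlin : ∀ (c : ℝ) (A B : Site d → Fin d → 𝔸), ops.Gop U.1 (c • A + B) = c • ops.Gop U.1 A + ops.Gop U.1 B)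
    {ω ω' : BSite L x → ℝ} (hω : ∀ v, 0 < ω v) (hω' : ∀ u, 0 ≤ ω' u)
    (f : {b : Site d × Fin d // InSomeBlock L x b} → 𝔸) {M : ℝ} (hM : 0 ≤ M) (hMf : ∀ y, ω (blkChoice L x y) * ‖f y‖ ≤ M)
    (b : {b : Site d × Fin d // InSomeBlock L x b}) :
    ω' (blkChoice L x b) * ‖ops.Gop U.1 (extZd (InSomeBlock L x) f) b.1.1 b.1.2‖ ≤
      B₀ * ((Finset.univ.sup' Finset.univ_nonempty fun u : BSite L x => ω' u * ((L : ℝ) ^ u.1.1 * x.i.η) ^ 2) *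
          (Finset.univ.sup' Finset.univ_nonempty fun v : BSite L x => (ω v)⁻¹)) * (Fintype.card (BSite L x) : ℝ) * M := by
  have hR : 0 ≤ (Finset.univ.sup' Finset.univ_nonempty fun u : BSite L x => ω' u * ((L : ℝ) ^ u.1.1 * x.i.η) ^ 2) *
      (Finset.univ.sup' Finset.univ_nonempty fun v : BSite L x => (ω v)⁻¹) := by
    obtain ⟨u₀⟩ := (inferInstance : Nonempty (BSite L x))
    have h1 : 0 ≤ Finset.univ.sup' Finset.univ_nonempty fun u : BSite L x => ω' u * ((L : ℝ) ^ u.1.1 * x.i.η) ^ 2 :=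
      (mul_nonneg (hω' u₀) (sq_nonneg _)).trans (Finset.le_sup' (fun u : BSite L x => ω' u * ((L : ℝ) ^ u.1.1 * x.i.η) ^ 2) (Finset.mem_univ u₀))
    have h2 : 0 ≤ Finset.univ.sup' Finset.univ_nonempty fun v : BSite L x => (ω v)⁻¹ :=
      (inv_nonneg.2 (hω u₀).le).trans (Finset.le_sup' (fun v : BSite L x => (ω v)⁻¹) (Finset.mem_univ u₀))
    exact mul_nonneg h1 h2
  refine weight_mul_norm_gop_le_of_ineq342 (len := len) hB₀ h342 hlin (blkChoice L x) (blkChoice_spec L x) (κ₂ := 0) hR hω hω'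
    (fun u v => exchangeLetter_of_fintype (a := fun u : BSite L x => ((L : ℝ) ^ u.1.1 * x.i.η) ^ 2) hω
      (fun u => mul_nonneg (hω' u) (sq_nonneg _)) u v)
    (fun u => ?_) f hM hMf b
  rw [sub_zero]
  exact rowLetter_of_fintype hδ₀ u

/-- the member-dependent exchange constant for a local factor `a`, non-negative. [cite: Balaban1984PropagatorsII, Lemma 2.1 (2.60) p.234 (bookkeeping)] -/
theorem exchangeConst_nonneg {x : MemberZd d L} [Fintype (BSite L x)] [Nonempty (BSite L x)] {ω ω' a : BSite L x → ℝ}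
    (hω : ∀ v, 0 < ω v) (hω'a : ∀ u, 0 ≤ ω' u * a u) :
    0 ≤ (Finset.univ.sup' Finset.univ_nonempty fun u => ω' u * a u) * (Finset.univ.sup' Finset.univ_nonempty fun v => (ω v)⁻¹) := by
  obtain ⟨u₀⟩ := (inferInstance : Nonempty (BSite L x))
  exact mul_nonneg ((hω'a u₀).trans (Finset.le_sup' (fun u => ω' u * a u) (Finset.mem_univ u₀)))
    ((inv_nonneg.2 (hω u₀).le).trans (Finset.le_sup' (fun v => (ω v)⁻¹) (Finset.mem_univ u₀)))

/-- ★ **ENTRY n = 1 (`∇_{U₀,ν}G(U₀)J`), member by member, letter-free** (local factor `Lʲη`; member-dependent constants).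
[cite: Balaban1985BackgroundPropagators, (3.47) p.398, (3.42) p.397; Balaban1984PropagatorsII, Lemma 2.1 p.234] -/
theorem weight_mul_norm_gradGop_le_of_ineq342_fintype {𝔸 : Type} [CStarAlgebra 𝔸] {len : Site d → ℝ} {x : MemberZd d L}
    [Fintype (BSite L x)] [Nonempty (BSite L x)] {ops : OpsZd d 𝔸} {U : CfgZd d 𝔸} {B₀ δ₀ : ℝ} (hB₀ : 0 ≤ B₀) (hδ₀ : 0 ≤ δ₀)
    (h342 : B9.Ineq342_346_347 (GAZdOfOps 𝔸 L len x ops) B₀ δ₀ U)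
    (hlin : ∀ (c : ℝ) (A B : Site d → Fin d → 𝔸), ops.Gop U.1 (c • A + B) = c • ops.Gop U.1 A + ops.Gop U.1 B)
    {ω ω' : BSite L x → ℝ} (hω : ∀ v, 0 < ω v) (hω' : ∀ u, 0 ≤ ω' u) (ν : Fin d)
    (f : {b : Site d × Fin d // InSomeBlock L x b} → 𝔸) {M : ℝ} (hM : 0 ≤ M) (hMf : ∀ y, ω (blkChoice L x y) * ‖f y‖ ≤ M)
    (b : {b : Site d × Fin d // InSomeBlock L x b}) :
    ω' (blkChoice L x b) * ‖B9SupplySockB9P3ZdLocalLettersOfOps.cdBZd x.i.η U.1 ν (ops.Gop U.1 (extZd (InSomeBlock L x) f)) b.1.1 b.1.2‖ ≤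
      B₀ * ((Finset.univ.sup' Finset.univ_nonempty fun u : BSite L x => ω' u * ((L : ℝ) ^ u.1.1 * x.i.η)) *
          (Finset.univ.sup' Finset.univ_nonempty fun v : BSite L x => (ω v)⁻¹)) * (Fintype.card (BSite L x) : ℝ) * M := by
  have ha : ∀ u : BSite L x, 0 ≤ ω' u * ((L : ℝ) ^ u.1.1 * x.i.η) := fun u =>
    mul_nonneg (hω' u) (by have := x.i.hη.le; positivity)
  refine B9Eq347GlobalFromLocalZd.weight_mul_norm_gradGop_le_of_ineq342 (len := len) hB₀ h342 hlin (blkChoice L x) (blkChoice_spec L x)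
    (κ₂ := 0) (exchangeConst_nonneg hω ha) hω hω'
    (fun u v => exchangeLetter_of_fintype (a := fun u : BSite L x => (L : ℝ) ^ u.1.1 * x.i.η) hω ha u v) (fun u => ?_) ν f hM hMf b
  rw [sub_zero]
  exact rowLetter_of_fintype hδ₀ u

/-- ★ **ENTRY n = 2 (`G(U₀)∇*_{U₀,ν}J`), member by member, letter-free** (local factor `Lʲη`; member-dependent constants).
[cite: Balaban1985BackgroundPropagators, (3.47) p.398, (3.42) p.397; Balaban1984PropagatorsII, Lemma 2.1 p.234] -/
theorem weight_mul_norm_gopDiv_le_of_ineq342_fintype {𝔸 : Type} [CStarAlgebra 𝔸] {len : Site d → ℝ} {x : MemberZd d L}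
    [Fintype (BSite L x)] [Nonempty (BSite L x)] {ops : OpsZd d 𝔸} {U : CfgZd d 𝔸} {B₀ δ₀ : ℝ} (hB₀ : 0 ≤ B₀) (hδ₀ : 0 ≤ δ₀)
    (h342 : B9.Ineq342_346_347 (GAZdOfOps 𝔸 L len x ops) B₀ δ₀ U)
    (hlin : ∀ (c : ℝ) (A B : Site d → Fin d → 𝔸), ops.Gop U.1 (c • A + B) = c • ops.Gop U.1 A + ops.Gop U.1 B)
    {ω ω' : BSite L x → ℝ} (hω : ∀ v, 0 < ω v) (hω' : ∀ u, 0 ≤ ω' u) (ν : Fin d)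
    (f : {b : Site d × Fin d // InSomeBlock L x b} → 𝔸) {M : ℝ} (hM : 0 ≤ M) (hMf : ∀ y, ω (blkChoice L x y) * ‖f y‖ ≤ M)
    (b : {b : Site d × Fin d // InSomeBlock L x b}) :
    ω' (blkChoice L x b) * ‖ops.Gop U.1 (B9SupplySockB9P3ZdLocalLettersOfOps.cdsBZd x.i.η U.1 ν (extZd (InSomeBlock L x) f)) b.1.1 b.1.2‖ ≤
      B₀ * ((Finset.univ.sup' Finset.univ_nonempty fun u : BSite L x => ω' u * ((L : ℝ) ^ u.1.1 * x.i.η)) *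
          (Finset.univ.sup' Finset.univ_nonempty fun v : BSite L x => (ω v)⁻¹)) * (Fintype.card (BSite L x) : ℝ) * M := by
  have ha : ∀ u : BSite L x, 0 ≤ ω' u * ((L : ℝ) ^ u.1.1 * x.i.η) := fun u =>
    mul_nonneg (hω' u) (by have := x.i.hη.le; positivity)
  refine B9Eq347GlobalFromLocalZd.weight_mul_norm_gopDiv_le_of_ineq342 (len := len) hB₀ h342 hlin (blkChoice L x) (blkChoice_spec L x)
    (κ₂ := 0) (exchangeConst_nonneg hω ha) hω hω'
    (fun u v => exchangeLetter_of_fintype (a := fun u : BSite L x => (L : ℝ) ^ u.1.1 * x.i.η) hω ha u v) (fun u => ?_) ν f hM hMf b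
  rw [sub_zero]
  exact rowLetter_of_fintype hδ₀ u

/-- ★ **ENTRY n = 3 (`Δ_{U₀}G(U₀)J`), member by member, letter-free** (local factor `1`; member-dependent constants).
[cite: Balaban1985BackgroundPropagators, (3.47) p.398, (3.42) p.397; Balaban1984PropagatorsII, Lemma 2.1 p.234] -/
theorem weight_mul_norm_lapGop_le_of_ineq342_fintype {𝔸 : Type} [CStarAlgebra 𝔸] {len : Site d → ℝ} {x : MemberZd d L}
    [Fintype (BSite L x)] [Nonempty (BSite L x)] {ops : OpsZd d 𝔸} {U : CfgZd d 𝔸} {B₀ δ₀ : ℝ} (hB₀ : 0 ≤ B₀) (hδ₀ : 0 ≤ δ₀)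
    (h342 : B9.Ineq342_346_347 (GAZdOfOps 𝔸 L len x ops) B₀ δ₀ U)
    (hlin : ∀ (c : ℝ) (A B : Site d → Fin d → 𝔸), ops.Gop U.1 (c • A + B) = c • ops.Gop U.1 A + ops.Gop U.1 B)
    {ω ω' : BSite L x → ℝ} (hω : ∀ v, 0 < ω v) (hω' : ∀ u, 0 ≤ ω' u)
    (f : {b : Site d × Fin d // InSomeBlock L x b} → 𝔸) {M : ℝ} (hM : 0 ≤ M) (hMf : ∀ y, ω (blkChoice L x y) * ‖f y‖ ≤ M)
    (b : {b : Site d × Fin d // InSomeBlock L x b}) :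
    ω' (blkChoice L x b) * ‖B9SupplySockB9P3ZdLocalLettersOfOps.lapBZd x.i.η U.1 (ops.Gop U.1 (extZd (InSomeBlock L x) f)) b.1.1 b.1.2‖ ≤
      B₀ * ((Finset.univ.sup' Finset.univ_nonempty fun u : BSite L x => ω' u * 1) *
          (Finset.univ.sup' Finset.univ_nonempty fun v : BSite L x => (ω v)⁻¹)) * (Fintype.card (BSite L x) : ℝ) * M := by
  have ha : ∀ u : BSite L x, 0 ≤ ω' u * (1 : ℝ) := fun u => by rw [mul_one]; exact hω' u
  refine B9Eq347GlobalFromLocalZd.weight_mul_norm_lapGop_le_of_ineq342 (len := len) hB₀ h342 hlin (blkChoice L x) (blkChoice_spec L x)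
    (κ₂ := 0) (exchangeConst_nonneg hω ha) hω hω'
    (fun u v => by simpa using exchangeLetter_of_fintype (a := fun _ : BSite L x => (1 : ℝ)) hω ha u v) (fun u => ?_) f hM hMf b
  rw [sub_zero]
  exact rowLetter_of_fintype hδ₀ u

end Literature.MathematicalPhysics.QuantumFieldTheory.Balaban1983to89.B9Eq347GlobalFromLocalZdFinite

end
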